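import Mathlib
import Summits.MatrixMultiplication.MatrixMultiplication.Theorems.SubgroupIdentityDesigns.Negative.LevelOneFloor
import Summits.MatrixMultiplication.MatrixMultiplication.Theorems.SubgroupIdentityDesigns.Negative.StandardLines
import Summits.MatrixMultiplication.MatrixMultiplication.Theorems.SubgroupIdentityDesigns.Negative.SingerWitness
import Summits.MatrixMultiplication.MatrixMultiplication.Theorems.SubgroupIdentityDesigns.Negative.NearFieldConj

/-!
# Level-one witnesses avoid the Dickson near-field group (witness form, all three members)

Route `LevelGradedCohnUmans`, crux `SubgroupIdentityDesigns`, the `(m,k) = (2,1)` cell.  A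
level-one WITNESS (TPP + level-`1` identity design + the crux inequality, `-2 < ε ≤ 1`, `p ≥ 3`)
has every member of order `≥ p + 1` (`levelOne_witness_window`) and pairwise disjoint members
(`subgroupTPP_disjoint`); so if a member `Hᵢ` contains a conjugate `x K x⁻¹` of the near-field
group `K` (`NearField`), any `h ≠ 1` of another member gives `k₀ = x⁻¹ h x ∉ K` and
`NearFieldConj` kills the design.  Net statements `no_levelOne_witness_of_nearField_member₁/₂/₃`:
NO MEMBER OF A LEVEL-ONE WITNESS CONTAINS A CONJUGATE OF THE DICKSON NEAR-FIELD GROUP (the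
non-cyclic regular subgroup of order `p² - 1` of `ΓL₁(𝔽_{p²})`).  With `SingerWitness` this covers
both regular subgroups of the Singer normaliser; at `p = 5` it removes the member class
`Z·C₃·⟨u·Frob⟩` (order `24`) from the residue recorded in `WitnessStatus`, leaving there only
members inside a conjugate of `Z·2.S₄ = N(Q₈)` (to which the split-monomial certificate applies).
VALUE = THEOREM, NOT summit progress; the crux item stmt-MatrixMultiplication-14079 is untouched
and remains open.
-/

set_option linter.dupNamespace false

noncomputable section

open scoped BigOperators Classical

open Summit.MatrixMultiplication.MatrixMultiplication.Theorems.LieRankDesigns.Negative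
  (GLm Mat budget)

open Literature.Barriers.MatrixMultiplication (SubgroupTPP)

namespace Summit.MatrixMultiplication.MatrixMultiplication.Theorems.SubgroupIdentityDesigns.Negative

section NearFieldWitness

variable {p : ℕ} [hp : Fact p.Prime]

/-- **No member `H₁` of a level-one witness contains a conjugate near-field group.** -/
theorem no_levelOne_witness_of_nearField_member₁ (hp3 : 3 ≤ p) {ε : ℝ} (hε : -2 < ε) (hε1 : ε ≤ 1)
    {H₁ H₂ H₃ : Subgroup (GLm p 2)} (htpp : SubgroupTPP H₁ H₂ H₃)
    (hdesign : ∃ c : Mat p 2 → ℂ, (∀ M, 1 < M.rank → c M = 0) ∧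
      (∑ M, c M * ZMod.stdAddChar (Matrix.trace (M * ((1 : GLm p 2) : Mat p 2)))) = 1 ∧
      ∀ a ∈ H₁, ∀ b ∈ H₂, ∀ g ∈ H₃, a * b * g ≠ 1 →
        (∑ M, c M *
          ZMod.stdAddChar (Matrix.trace (M * ((a * b * g : GLm p 2) : Mat p 2)))) = 0)
    (hwit : budget p 2 1 (2 + ε) <
      ((Nat.card H₁ * Nat.card H₂ * Nat.card H₃ : ℕ) : ℝ) ^ ((2 + ε) / 3))
    (n : ZMod p) (hn : ∀ x : ZMod p, x * x ≠ n) (K : Subgroup (GLm p 2))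
    (hKshape : ∀ k ∈ K,
      (((k : GLm p 2) : Mat p 2) 0 1 = n * ((k : GLm p 2) : Mat p 2) 1 0 ∧
        ((k : GLm p 2) : Mat p 2) 1 1 = ((k : GLm p 2) : Mat p 2) 0 0 ∧
        IsSquare (((k : GLm p 2) : Mat p 2) 0 0 * ((k : GLm p 2) : Mat p 2) 0 0 -
          n * (((k : GLm p 2) : Mat p 2) 1 0 * ((k : GLm p 2) : Mat p 2) 1 0))) ∨
      (((k : GLm p 2) : Mat p 2) 0 1 = -(n * ((k : GLm p 2) : Mat p 2) 1 0) ∧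
        ((k : GLm p 2) : Mat p 2) 1 1 = -((k : GLm p 2) : Mat p 2) 0 0 ∧
        ¬ IsSquare (((k : GLm p 2) : Mat p 2) 0 0 * ((k : GLm p 2) : Mat p 2) 0 0 -
          n * (((k : GLm p 2) : Mat p 2) 1 0 * ((k : GLm p 2) : Mat p 2) 1 0))))
    (hKall₁ : ∀ k : GLm p 2, (k : Mat p 2) 0 1 = n * (k : Mat p 2) 1 0 →
      (k : Mat p 2) 1 1 = (k : Mat p 2) 0 0 →
      IsSquare ((k : Mat p 2) 0 0 * (k : Mat p 2) 0 0 - n * ((k : Mat p 2) 1 0 * (k : Mat p 2) 1 0)) →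
      k ∈ K)
    (hKall₂ : ∀ k : GLm p 2, (k : Mat p 2) 0 1 = -(n * (k : Mat p 2) 1 0) →
      (k : Mat p 2) 1 1 = -(k : Mat p 2) 0 0 →
      ¬ IsSquare ((k : Mat p 2) 0 0 * (k : Mat p 2) 0 0 -
        n * ((k : Mat p 2) 1 0 * (k : Mat p 2) 1 0)) →
      k ∈ K)
    (x : GLm p 2) (hKH : ∀ k ∈ K, x * k * x⁻¹ ∈ H₁) : False := by
  obtain ⟨-, ⟨hlo, -⟩, -⟩ := levelOne_witness_window hp3 hε hε1 htpp hdesign hwit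
  obtain ⟨h, hh, hh1⟩ := exists_ne_one_of_card_ge hlo
  have hconj : x * (x⁻¹ * h * x) * x⁻¹ = h := by group
  refine no_levelOne_design_of_nearField_conj₁₂ n hn K hKshape hKall₁ hKall₂ x hKH
    (x⁻¹ * h * x) (by rw [hconj]; exact hh) (fun hk => hh1 ?_) hdesign
  have hKi := hKH _ hk
  rw [hconj] at hKi
  exact Subgroup.disjoint_def.mp (StandardLines.subgroupTPP_disjoint htpp).1 hKi hh

/-- **No member `H₂` of a level-one witness contains a conjugate near-field group.** -/
theorem no_levelOne_witness_of_nearField_member₂ (hp3 : 3 ≤ p) {ε : ℝ} (hε : -2 < ε) (hε1 : ε ≤ 1)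
    {H₁ H₂ H₃ : Subgroup (GLm p 2)} (htpp : SubgroupTPP H₁ H₂ H₃)
    (hdesign : ∃ c : Mat p 2 → ℂ, (∀ M, 1 < M.rank → c M = 0) ∧
      (∑ M, c M * ZMod.stdAddChar (Matrix.trace (M * ((1 : GLm p 2) : Mat p 2)))) = 1 ∧
      ∀ a ∈ H₁, ∀ b ∈ H₂, ∀ g ∈ H₃, a * b * g ≠ 1 →
        (∑ M, c M *
          ZMod.stdAddChar (Matrix.trace (M * ((a * b * g : GLm p 2) : Mat p 2)))) = 0)
    (hwit : budget p 2 1 (2 + ε) <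
      ((Nat.card H₁ * Nat.card H₂ * Nat.card H₃ : ℕ) : ℝ) ^ ((2 + ε) / 3))
    (n : ZMod p) (hn : ∀ x : ZMod p, x * x ≠ n) (K : Subgroup (GLm p 2))
    (hKshape : ∀ k ∈ K,
      (((k : GLm p 2) : Mat p 2) 0 1 = n * ((k : GLm p 2) : Mat p 2) 1 0 ∧
        ((k : GLm p 2) : Mat p 2) 1 1 = ((k : GLm p 2) : Mat p 2) 0 0 ∧
        IsSquare (((k : GLm p 2) : Mat p 2) 0 0 * ((k : GLm p 2) : Mat p 2) 0 0 -
          n * (((k : GLm p 2) : Mat p 2) 1 0 * ((k : GLm p 2) : Mat p 2) 1 0))) ∨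
      (((k : GLm p 2) : Mat p 2) 0 1 = -(n * ((k : GLm p 2) : Mat p 2) 1 0) ∧
        ((k : GLm p 2) : Mat p 2) 1 1 = -((k : GLm p 2) : Mat p 2) 0 0 ∧
        ¬ IsSquare (((k : GLm p 2) : Mat p 2) 0 0 * ((k : GLm p 2) : Mat p 2) 0 0 -
          n * (((k : GLm p 2) : Mat p 2) 1 0 * ((k : GLm p 2) : Mat p 2) 1 0))))
    (hKall₁ : ∀ k : GLm p 2, (k : Mat p 2) 0 1 = n * (k : Mat p 2) 1 0 →
      (k : Mat p 2) 1 1 = (k : Mat p 2) 0 0 →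
      IsSquare ((k : Mat p 2) 0 0 * (k : Mat p 2) 0 0 - n * ((k : Mat p 2) 1 0 * (k : Mat p 2) 1 0)) →
      k ∈ K)
    (hKall₂ : ∀ k : GLm p 2, (k : Mat p 2) 0 1 = -(n * (k : Mat p 2) 1 0) →
      (k : Mat p 2) 1 1 = -(k : Mat p 2) 0 0 →
      ¬ IsSquare ((k : Mat p 2) 0 0 * (k : Mat p 2) 0 0 -
        n * ((k : Mat p 2) 1 0 * (k : Mat p 2) 1 0)) →
      k ∈ K)
    (x : GLm p 2) (hKH : ∀ k ∈ K, x * k * x⁻¹ ∈ H₂) : False := by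
  obtain ⟨⟨hlo, -⟩, -, -⟩ := levelOne_witness_window hp3 hε hε1 htpp hdesign hwit
  obtain ⟨h, hh, hh1⟩ := exists_ne_one_of_card_ge hlo
  have hconj : x * (x⁻¹ * h * x) * x⁻¹ = h := by group
  refine no_levelOne_design_of_nearField_conj₂₁ n hn K hKshape hKall₁ hKall₂ x hKH
    (x⁻¹ * h * x) (by rw [hconj]; exact hh) (fun hk => hh1 ?_) hdesign
  have hKi := hKH _ hk
  rw [hconj] at hKi
  exact Subgroup.disjoint_def.mp (StandardLines.subgroupTPP_disjoint htpp).1 hh hKi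

/-- **No member `H₃` of a level-one witness contains a conjugate near-field group.** -/
theorem no_levelOne_witness_of_nearField_member₃ (hp3 : 3 ≤ p) {ε : ℝ} (hε : -2 < ε) (hε1 : ε ≤ 1)
    {H₁ H₂ H₃ : Subgroup (GLm p 2)} (htpp : SubgroupTPP H₁ H₂ H₃)
    (hdesign : ∃ c : Mat p 2 → ℂ, (∀ M, 1 < M.rank → c M = 0) ∧
      (∑ M, c M * ZMod.stdAddChar (Matrix.trace (M * ((1 : GLm p 2) : Mat p 2)))) = 1 ∧
      ∀ a ∈ H₁, ∀ b ∈ H₂, ∀ g ∈ H₃, a * b * g ≠ 1 →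
        (∑ M, c M *
          ZMod.stdAddChar (Matrix.trace (M * ((a * b * g : GLm p 2) : Mat p 2)))) = 0)
    (hwit : budget p 2 1 (2 + ε) <
      ((Nat.card H₁ * Nat.card H₂ * Nat.card H₃ : ℕ) : ℝ) ^ ((2 + ε) / 3))
    (n : ZMod p) (hn : ∀ x : ZMod p, x * x ≠ n) (K : Subgroup (GLm p 2))
    (hKshape : ∀ k ∈ K,
      (((k : GLm p 2) : Mat p 2) 0 1 = n * ((k : GLm p 2) : Mat p 2) 1 0 ∧
        ((k : GLm p 2) : Mat p 2) 1 1 = ((k : GLm p 2) : Mat p 2) 0 0 ∧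
        IsSquare (((k : GLm p 2) : Mat p 2) 0 0 * ((k : GLm p 2) : Mat p 2) 0 0 -
          n * (((k : GLm p 2) : Mat p 2) 1 0 * ((k : GLm p 2) : Mat p 2) 1 0))) ∨
      (((k : GLm p 2) : Mat p 2) 0 1 = -(n * ((k : GLm p 2) : Mat p 2) 1 0) ∧
        ((k : GLm p 2) : Mat p 2) 1 1 = -((k : GLm p 2) : Mat p 2) 0 0 ∧
        ¬ IsSquare (((k : GLm p 2) : Mat p 2) 0 0 * ((k : GLm p 2) : Mat p 2) 0 0 -
          n * (((k : GLm p 2) : Mat p 2) 1 0 * ((k : GLm p 2) : Mat p 2) 1 0))))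
    (hKall₁ : ∀ k : GLm p 2, (k : Mat p 2) 0 1 = n * (k : Mat p 2) 1 0 →
      (k : Mat p 2) 1 1 = (k : Mat p 2) 0 0 →
      IsSquare ((k : Mat p 2) 0 0 * (k : Mat p 2) 0 0 - n * ((k : Mat p 2) 1 0 * (k : Mat p 2) 1 0)) →
      k ∈ K)
    (hKall₂ : ∀ k : GLm p 2, (k : Mat p 2) 0 1 = -(n * (k : Mat p 2) 1 0) →
      (k : Mat p 2) 1 1 = -(k : Mat p 2) 0 0 →
      ¬ IsSquare ((k : Mat p 2) 0 0 * (k : Mat p 2) 0 0 -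
        n * ((k : Mat p 2) 1 0 * (k : Mat p 2) 1 0)) →
      k ∈ K)
    (x : GLm p 2) (hKH : ∀ k ∈ K, x * k * x⁻¹ ∈ H₃) : False := by
  obtain ⟨⟨hlo, -⟩, -, -⟩ := levelOne_witness_window hp3 hε hε1 htpp hdesign hwit
  obtain ⟨h, hh, hh1⟩ := exists_ne_one_of_card_ge hlo
  have hconj : x * (x⁻¹ * h * x) * x⁻¹ = h := by group
  refine no_levelOne_design_of_nearField_conj₃₁ n hn K hKshape hKall₁ hKall₂ x hKH
    (x⁻¹ * h * x) (by rw [hconj]; exact hh) (fun hk => hh1 ?_) hdesign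
  have hKi := hKH _ hk
  rw [hconj] at hKi
  exact Subgroup.disjoint_def.mp (StandardLines.subgroupTPP_disjoint htpp).2.1 hh hKi

end NearFieldWitness

end Summit.MatrixMultiplication.MatrixMultiplication.Theorems.SubgroupIdentityDesigns.Negative

end
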